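import Mathlib
import HarnessLib

/-!
# LINE (A) `product_plus_one` — closed forms of the θ-tower of an unswitched incoherent trinomial row and of a cloud (definitions only)

Crux item stmt-ValiantsHypothesis-18050, LINE (A) floor structure (memo `pub/val-lit/lmr/NOTE-p7g15-18050-LINEA-incoherent-cell.md` §11–§12).
One row `A − B x^p − C x^q` (`p = e₁+1`, `q = e₁+e₂+2`), `θ = x·d/dx`:

* `rowH e₁ e₂ k B C x = p^k B x^p + q^k C x^q` (`θ^k` of `B x^p + C x^q`);  `rowU e₁ e₂ A B C x = (A − B x^p − C x^q)⁻¹`;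
* `rowPsi0 … = H₁u` (the row's pull `−Φ`), `rowPsi1 = H₂u + H₁²u²` (`θψ`), `rowPsi2 = H₃u + 3H₁H₂u² + 2H₁³u³` (`θ²ψ`),
  `rowPsi3 = H₄u + (4H₁H₃ + 3H₂²)u² + 12H₁²H₂u³ + 6H₁⁴u⁴` (`θ³ψ`);
* `cloudP0 … cloudP3 e₁ e₂ s m A B C x = Σ_{i ∈ s} m_i · rowPsi_k e₁ e₂ (A i) (B i) (C i) x` — the pull of a weighted cloud and its tower.

Plain `noncomputable def`s of real numbers; no structure / instance / notation / axiom.  That these ARE the derivatives is proved in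
`…ProductPlusOneCloudCalculus` / `…CloudMonotone`.  Honest framing: definitions only; nothing closes; `OneChangeFloorK3` / 18050 / `MatrixDescartes`
OPEN; `VP ≠ VNP` NOT proved.
-/

set_option linter.dupNamespace false

namespace Summit.ValiantsHypothesis.ValiantsHypothesis.Theorems.LacunarySymmetroidMatrixDescartes

namespace ProductPlusOne

open Finset
open scoped BigOperators

/-- `θ^k (B x^p + C x^q) = p^k B x^p + q^k C x^q` (`p = e₁+1`, `q = e₁+e₂+2`). -/
noncomputable def rowH (e₁ e₂ k : ℕ) (B C x : ℝ) : ℝ :=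
  ((e₁ : ℝ) + 1) ^ k * B * x ^ (e₁ + 1) + ((e₁ : ℝ) + e₂ + 2) ^ k * C * x ^ (e₁ + e₂ + 2)

/-- `u = (A − B x^p − C x^q)⁻¹`, the inverse of the (unswitched) row. -/
noncomputable def rowU (e₁ e₂ : ℕ) (A B C x : ℝ) : ℝ := (A - B * x ^ (e₁ + 1) - C * x ^ (e₁ + e₂ + 2))⁻¹

/-- `ψ = H₁u`: the row's pull (minus its Euler ratio at the bottom coupling, stripped). -/
noncomputable def rowPsi0 (e₁ e₂ : ℕ) (A B C x : ℝ) : ℝ := rowH e₁ e₂ 1 B C x * rowU e₁ e₂ A B C x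

/-- `θψ = H₂u + H₁²u²`. -/
noncomputable def rowPsi1 (e₁ e₂ : ℕ) (A B C x : ℝ) : ℝ :=
  rowH e₁ e₂ 2 B C x * rowU e₁ e₂ A B C x + rowH e₁ e₂ 1 B C x ^ 2 * rowU e₁ e₂ A B C x ^ 2

/-- `θ²ψ = H₃u + 3H₁H₂u² + 2H₁³u³`. -/
noncomputable def rowPsi2 (e₁ e₂ : ℕ) (A B C x : ℝ) : ℝ :=
  rowH e₁ e₂ 3 B C x * rowU e₁ e₂ A B C x + 3 * rowH e₁ e₂ 1 B C x * rowH e₁ e₂ 2 B C x * rowU e₁ e₂ A B C x ^ 2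
    + 2 * rowH e₁ e₂ 1 B C x ^ 3 * rowU e₁ e₂ A B C x ^ 3

/-- `θ³ψ = H₄u + (4H₁H₃ + 3H₂²)u² + 12H₁²H₂u³ + 6H₁⁴u⁴`. -/
noncomputable def rowPsi3 (e₁ e₂ : ℕ) (A B C x : ℝ) : ℝ :=
  rowH e₁ e₂ 4 B C x * rowU e₁ e₂ A B C x
    + (4 * rowH e₁ e₂ 1 B C x * rowH e₁ e₂ 3 B C x + 3 * rowH e₁ e₂ 2 B C x ^ 2) * rowU e₁ e₂ A B C x ^ 2
    + 12 * rowH e₁ e₂ 1 B C x ^ 2 * rowH e₁ e₂ 2 B C x * rowU e₁ e₂ A B C x ^ 3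
    + 6 * rowH e₁ e₂ 1 B C x ^ 4 * rowU e₁ e₂ A B C x ^ 4

variable {ι : Type*}

/-- The cloud's pull `P0 = Σ m_i ψ_i`. -/
noncomputable def cloudP0 (e₁ e₂ : ℕ) (s : Finset ι) (m A B C : ι → ℝ) (x : ℝ) : ℝ :=
  ∑ i ∈ s, m i * rowPsi0 e₁ e₂ (A i) (B i) (C i) x

/-- `P1 = θP0 = Σ m_i θψ_i`. -/
noncomputable def cloudP1 (e₁ e₂ : ℕ) (s : Finset ι) (m A B C : ι → ℝ) (x : ℝ) : ℝ :=
  ∑ i ∈ s, m i * rowPsi1 e₁ e₂ (A i) (B i) (C i) x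

/-- `P2 = θ²P0`. -/
noncomputable def cloudP2 (e₁ e₂ : ℕ) (s : Finset ι) (m A B C : ι → ℝ) (x : ℝ) : ℝ :=
  ∑ i ∈ s, m i * rowPsi2 e₁ e₂ (A i) (B i) (C i) x

/-- `P3 = θ³P0`. -/
noncomputable def cloudP3 (e₁ e₂ : ℕ) (s : Finset ι) (m A B C : ι → ℝ) (x : ℝ) : ℝ :=
  ∑ i ∈ s, m i * rowPsi3 e₁ e₂ (A i) (B i) (C i) x

end ProductPlusOne

end Summit.ValiantsHypothesis.ValiantsHypothesis.Theorems.LacunarySymmetroidMatrixDescartes
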